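import Summits.ABC.StewartYu.PadicMultiquadraticLiouville
import HarnessLib

/-!
# Cell abc-stewartyu, WP-A3 (ii′): the SHARP `p`-adic Liouville inequality in `ℚ(√α₁, …, √αₖ) ⊂ ℚ_p`
# (exponent `2ᵏ`)

`Summits/ABC/StewartYu/PadicMultiquadraticLiouvilleSharp.lean` — cell `abc-stewartyu` (HOME
`run/shared/lean/pub/abc-stewartyu/`, seat p3, work package WP-A3 of `HOME/p2/PADIC-CORE.md` and
row "W80Liouville" of `HOME/plan/PORT-MAP.md`; theorems only, no definition, no named fact), sequel to
`PadicMultiquadraticLiouville.lean` (exponent `4^{k+1}`, the Cijsouw–Waldschmidt 1977 quality).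

The `p`-adic twin of the tree's `Waldschmidt1980.abs_ev_ge_sharp` (file
`Waldschmidt1980Liouville.lean`, potential `M/(4 D M P²)^{2ᵏ}`): under the hypotheses of
`Multiquad.norm_evL_ge` (rationals `αⱼ` with `𝔽₂`-independent square classes, `p`-adic integers
`sⱼ ∈ ℚ_p` with `sⱼ² = αⱼ`, a non-zero coefficient vector `c` with `D c_S ∈ ℤ`, `∑ |c_S| ≤ M`, `M ≥ 1`)

  `‖∑_S c_S ∏_{j∈S} sⱼ‖_p ≥ D / (4 D² M (∏ⱼ H(αⱼ))³)^{2ᵏ}`   (`norm_evL_ge_sharp`),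

`H(α) = max(|num α|, den α)`. The induction on `k` is the same as in the archimedean file (norm
`x x̄ = u² − αₖ v²` via `evL_cmul`, conjugate `x̄ ≠ 0` by `evL_ne_zero`); what changes is the
book-keeping of the potential: the archimedean step credits the numerator `M` against the SIZE
`|x̄| ≤ H M P` of the conjugate, whereas `p`-adically the conjugate costs `‖x̄‖_p ≤ D`
(`norm_evL_le_natCast`), so the credit is the numerator `D`, renewed at each level by `D'' ≥ D²`,
and the potential carries `D²` and `P³` (`padic_numeric_step_sharp`). The base `k = 0` is the product
formula for a rational `z/D` with `|z| ≤ D M`: `‖z/D‖_p ≥ ‖z‖_p ≥ 1/|z| ≥ 1/(D M)` (`norm_evL_ge_base`).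
Consequence for the parameter files of the `p`-adic core (PORT-MAP §1b): the order of zeros `T` may
carry W80's factor `2^m` instead of `4^{m+1}`. Everything is [folklore]; nothing is claimed in print.
-/

noncomputable section

open Finset Literature.NumberTheory.Transcendental.CW77

namespace Summit.ABC.StewartYu


namespace Multiquad

open Literature.NumberTheory.Transcendental

variable {p : ℕ} [Fact p.Prime] {k : ℕ}

/-- The base of the induction (no roots): a non-zero rational `c_∅ = z/D` with `|c_∅| ≤ M` has
`‖c_∅‖_p ≥ ‖z‖_p ≥ 1/|z| ≥ 1/(DM)`. [folklore] -/
theorem norm_evL_ge_base (s : Fin 0 → ℚ_[p]) {c : Finset (Fin 0) → ℚ} (hc : c ≠ 0) {D : ℕ}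
    (hD : 1 ≤ D) (hden : ∀ S, ∃ z : ℤ, (D : ℚ) * c S = z) {M : ℝ} (hcM : ∑ S, |(c S : ℝ)| ≤ M) :
    1 / ((D : ℝ) * M) ≤ ‖evL s c‖ := by
  have huniv : (univ : Finset (Finset (Fin 0))) = {∅} := by
    ext S
    simp only [Finset.mem_univ, Finset.mem_singleton, true_iff]
    exact Finset.eq_empty_of_isEmpty S
  have hev : evL s c = ((c ∅ : ℚ) : ℚ_[p]) := by
    unfold evL
    rw [huniv, Finset.sum_singleton]
    unfold monoL
    rw [Finset.prod_empty, mul_one]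
  have hc0 : c ∅ ≠ 0 := by
    intro h; apply hc; funext S
    have : S = ∅ := Finset.eq_empty_of_isEmpty S
    rw [this, h]; rfl
  obtain ⟨z, hz⟩ := hden ∅
  have hD0 : (D : ℚ) ≠ 0 := by exact_mod_cast (show D ≠ 0 by omega)
  have hz0 : z ≠ 0 := by
    rintro rfl
    rw [Int.cast_zero, mul_eq_zero] at hz
    rcases hz with h | h
    · exact hD0 h
    · exact hc0 h
  have hcz : c ∅ = (z : ℚ) / D := by
    field_simp; rw [mul_comm]; exact hz
  have hcM' : |((c ∅ : ℚ) : ℝ)| ≤ M := by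
    have : |((c ∅ : ℚ) : ℝ)| ≤ ∑ S, |(c S : ℝ)| := by
      rw [huniv, Finset.sum_singleton]
    exact this.trans hcM
  have hDR : (0 : ℝ) < D := by exact_mod_cast (show 0 < D by omega)
  have hzle : |(z : ℝ)| ≤ D * M := by
    have h1 : ((c ∅ : ℚ) : ℝ) = (z : ℝ) / D := by rw [hcz]; push_cast; rfl
    rw [h1, abs_div, abs_of_pos hDR, div_le_iff₀ hDR] at hcM'
    linarith [hcM']
  have hzabs : (0 : ℝ) < |(z : ℝ)| := by
    have : (z : ℝ) ≠ 0 := by exact_mod_cast hz0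
    exact abs_pos.mpr this
  have hnormD : ‖(D : ℚ_[p])‖ ≤ 1 := by
    have := Padic.norm_int_le_one (p := p) (D : ℤ)
    simpa using this
  have hnormD0 : 0 < ‖(D : ℚ_[p])‖ :=
    norm_pos_iff.mpr (Nat.cast_ne_zero.mpr (show D ≠ 0 by omega))
  have hge : ‖((z : ℚ) : ℚ_[p])‖ ≤ ‖evL s c‖ := by
    rw [hev, hcz, Rat.cast_div, Rat.cast_intCast, Rat.cast_natCast, norm_div]
    rw [le_div_iff₀ hnormD0]
    calc ‖((z : ℚ) : ℚ_[p])‖ * ‖(D : ℚ_[p])‖ ≤ ‖((z : ℚ) : ℚ_[p])‖ * 1 :=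
          mul_le_mul_of_nonneg_left hnormD (norm_nonneg _)
      _ = ‖((z : ℤ) : ℚ_[p])‖ := by rw [mul_one, Rat.cast_intCast]
  have hz1 : 1 / |(z : ℝ)| ≤ ‖((z : ℚ) : ℚ_[p])‖ := by
    rw [Rat.cast_intCast]; exact inv_abs_le_norm_intCast hz0
  calc 1 / ((D : ℝ) * M) ≤ 1 / |(z : ℝ)| := one_div_le_one_div_of_le hzabs hzle
    _ ≤ ‖((z : ℚ) : ℚ_[p])‖ := hz1
    _ ≤ ‖evL s c‖ := hge

/-- The numerical step of the SHARP `p`-adic induction: from `D''/(4 D''² M'' P³)^E ≤ y`,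
`D² ≤ D'' ≤ D² P H`, `M'' = 2 H P M²` and `y ≤ x · D` we get `D/(4 D² M (PH)³)^{2E} ≤ x`
(`4 D''² M'' P³ ≤ 8 D⁴ M² P⁶ H³ ≤ (4 D² M P³ H³)² = 16 D⁴ M² P⁶ H⁶`; the numerator `D''` pays
the `p`-adic loss `‖x̄‖_p ≤ D` and renews the credit `D`). [folklore] -/
theorem padic_numeric_step_sharp {D M H P y x D'' : ℝ} {E : ℕ} (hD : 1 ≤ D) (hM : 1 ≤ M)
    (hH : 1 ≤ H) (hP : 1 ≤ P) (hD''ge : D ^ 2 ≤ D'') (hD''le : D'' ≤ D ^ 2 * P * H)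
    (hy : D'' / (4 * D'' ^ 2 * (2 * H * P * M ^ 2) * P ^ 3) ^ E ≤ y) (hxy : y ≤ x * D) :
    D / (4 * D ^ 2 * M * (P * H) ^ 3) ^ (2 * E) ≤ x := by
  have hD0 : 0 < D := by linarith
  set old : ℝ := 4 * D'' ^ 2 * (2 * H * P * M ^ 2) * P ^ 3 with hold
  have hD''0 : 0 < D'' := lt_of_lt_of_le (by positivity) hD''ge
  have hold0 : 0 < old := by positivity
  -- `x ≥ y / D ≥ D''/(old^E D) ≥ D/old^E`
  have hx : D / old ^ E ≤ x := by
    have h1 : D'' / old ^ E ≤ x * D := hy.trans hxy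
    have h2 : D * D ≤ D'' := by rw [← sq]; exact hD''ge
    have h3 : D / old ^ E * D ≤ x * D := by
      calc D / old ^ E * D = (D * D) / old ^ E := by ring
        _ ≤ D'' / old ^ E := div_le_div_of_nonneg_right h2 (by positivity)
        _ ≤ x * D := h1
    exact le_of_mul_le_mul_right h3 hD0
  refine le_trans ?_ hx
  -- `old ≤ (4 D² M (PH)³)²`
  have hbase : old ≤ (4 * D ^ 2 * M * (P * H) ^ 3) ^ 2 := by
    have h1 : old ≤ 4 * (D ^ 2 * P * H) ^ 2 * (2 * H * P * M ^ 2) * P ^ 3 := by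
      rw [hold]
      have : 0 ≤ (2 * H * P * M ^ 2) * P ^ 3 := by positivity
      have hsq : D'' ^ 2 ≤ (D ^ 2 * P * H) ^ 2 := pow_le_pow_left₀ hD''0.le hD''le 2
      nlinarith
    have h2 : 4 * (D ^ 2 * P * H) ^ 2 * (2 * H * P * M ^ 2) * P ^ 3 =
        8 * D ^ 4 * M ^ 2 * P ^ 6 * H ^ 3 := by ring
    have h3 : (4 * D ^ 2 * M * (P * H) ^ 3) ^ 2 = 16 * D ^ 4 * M ^ 2 * P ^ 6 * H ^ 6 := by ring
    rw [h2] at h1; rw [h3]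
    have hH3 : H ^ 3 ≤ H ^ 6 := pow_le_pow_right₀ hH (by norm_num)
    have h0 : 0 ≤ 8 * D ^ 4 * M ^ 2 * P ^ 6 := by positivity
    nlinarith
  have hpow : old ^ E ≤ (4 * D ^ 2 * M * (P * H) ^ 3) ^ (2 * E) := by
    rw [pow_mul]; exact pow_le_pow_left₀ hold0.le hbase E
  exact div_le_div_of_nonneg_left hD0.le (by positivity) hpow

set_option maxHeartbeats 800000 in
/-- **The SHARP `p`-adic Liouville inequality in `ℚ(√α₁, …, √αₖ) ⊂ ℚ_p`** (exponent `2ᵏ`): under the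
hypotheses of `norm_evL_ge`,
`‖∑_S c_S ∏_{j∈S} sⱼ‖_p ≥ D / (4 D² M (∏ⱼ H(αⱼ))³)^{2ᵏ}`.
The `p`-adic twin of the tree's `Waldschmidt1980.abs_ev_ge_sharp` (`M/(4 D M P²)^{2ᵏ}`): the
archimedean induction credits the numerator `M` against the size `|x̄| ≤ HMP` of the conjugate; here
the conjugate costs `‖x̄‖_p ≤ D` instead, so the credit is the numerator `D` (renewed by `D'' ≥ D²`)
and the potential carries `D²` and `P³`. [folklore] -/
theorem norm_evL_ge_sharp : ∀ (k : ℕ) (α : Fin k → ℚ),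
    (∀ T : Finset (Fin k), T.Nonempty → ¬ IsSquare (∏ j ∈ T, α j)) →
    ∀ (s : Fin k → ℚ_[p]), (∀ j, s j * s j = (α j : ℚ_[p])) → (∀ j, ‖s j‖ ≤ 1) →
    ∀ (c : Finset (Fin k) → ℚ), c ≠ 0 → ∀ (D : ℕ), 1 ≤ D → (∀ S, ∃ z : ℤ, (D : ℚ) * c S = z) →
    ∀ (M : ℝ), 1 ≤ M → ∑ S, |(c S : ℝ)| ≤ M →
    (D : ℝ) / (4 * (D : ℝ) ^ 2 * M * heightProd α ^ 3) ^ (2 ^ k) ≤ ‖evL s c‖ := by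
  intro k
  induction k with
  | zero =>
    intro α hind s hs hs1 c hc D hD hden M hM hcM
    have hbase := norm_evL_ge_base s hc hD hden hcM
    have hP : heightProd α = 1 := by unfold heightProd; simp
    rw [hP, one_pow, mul_one, pow_zero, pow_one]
    have hD1 : (1 : ℝ) ≤ D := by exact_mod_cast hD
    have hDM : 0 < (D : ℝ) * M := by positivity
    refine le_trans ?_ hbase
    rw [div_le_div_iff₀ (by positivity) hDM]
    nlinarith
  | succ k ih =>
    intro α' hind s' hs' hs1' c hc D hD hden M hM hcM
    set a : ℚ := α' (Fin.last k) with ha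
    set α : Fin k → ℚ := init α' with hαdef
    set s : Fin k → ℚ_[p] := initL s' with hsdef
    have hs : ∀ j, s j * s j = (α j : ℚ_[p]) := fun j => hs' _
    have hs1 : ∀ j, ‖s j‖ ≤ 1 := fun j => hs1' _
    have hindα : ∀ T : Finset (Fin k), T.Nonempty → ¬ IsSquare (∏ j ∈ T, α j) := hind_init α' hind
    set H : ℝ := hgt a with hH
    set P : ℝ := heightProd α with hP
    have hH1 : 1 ≤ H := one_le_hgt a
    have hP1 : 1 ≤ P := one_le_heightProd α
    have hP' : heightProd α' = P * H := by
      rw [hP, hH, ha]; unfold heightProd; rw [Fin.prod_univ_castSucc]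
    have hD1 : (1 : ℝ) ≤ D := by exact_mod_cast hD
    set u : ℚ_[p] := evL s (lo c) with hu
    set v : ℚ_[p] := evL s (hi c) with hv
    set r : ℚ_[p] := s' (Fin.last k) with hr
    have hrr : r * r = (a : ℚ_[p]) := hs' (Fin.last k)
    have hx : evL s' c = u + r * v := evL_succ s' c
    have hsum := sum_abs_succ c
    have hlo_le : ∑ S, |(lo c S : ℝ)| ≤ M := by
      have : 0 ≤ ∑ S, |(hi c S : ℝ)| := Finset.sum_nonneg fun S _ => abs_nonneg _
      linarith
    have hhi_le : ∑ S, |(hi c S : ℝ)| ≤ M := by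
      have : 0 ≤ ∑ S, |(lo c S : ℝ)| := Finset.sum_nonneg fun S _ => abs_nonneg _
      linarith
    have hden_lo : ∀ S, ∃ z : ℤ, (D : ℚ) * lo c S = z := fun S => hden _
    have hden_hi : ∀ S, ∃ z : ℤ, (D : ℚ) * hi c S = z := fun S => hden _
    have hE : 2 ^ (k + 1) = 2 * 2 ^ k := by ring
    rcases eq_or_ne (hi c) 0 with hhi0 | hhi0
    · -- no last root
      have hlo0 : lo c ≠ 0 := (lo_hi_ne_zero hc).resolve_right (fun h => h hhi0)
      have key := ih α hindα s hs hs1 (lo c) hlo0 D hD hden_lo M hM hlo_le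
      have hv0 : v = 0 := by rw [hv, hhi0, evL_zero]
      have hx' : evL s' c = u := by rw [hx, hv0]; ring
      rw [hx']
      refine le_trans ?_ key
      rw [hP']
      have hb1 : (1 : ℝ) ≤ 4 * (D : ℝ) ^ 2 * M * P ^ 3 := by
        have := one_le_mul_of_one_le_of_one_le (one_le_mul_of_one_le_of_one_le (one_le_pow₀ hD1 (n := 2)) hM)
          (one_le_pow₀ hP1 (n := 3))
        nlinarith
      have hb : 4 * (D : ℝ) ^ 2 * M * P ^ 3 ≤ 4 * (D : ℝ) ^ 2 * M * (P * H) ^ 3 := by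
        have hPH : P ^ 3 ≤ (P * H) ^ 3 :=
          pow_le_pow_left₀ (by positivity) (le_mul_of_one_le_right (by positivity) hH1) 3
        exact mul_le_mul_of_nonneg_left hPH (by positivity)
      apply div_le_div_of_nonneg_left (by positivity) (by positivity)
      calc (4 * (D : ℝ) ^ 2 * M * P ^ 3) ^ 2 ^ k ≤ (4 * (D : ℝ) ^ 2 * M * (P * H) ^ 3) ^ 2 ^ k :=
            pow_le_pow_left₀ (by positivity) hb _
        _ ≤ (4 * (D : ℝ) ^ 2 * M * (P * H) ^ 3) ^ 2 ^ (k + 1) :=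
            pow_le_pow_right₀ (hb1.trans hb) (Nat.pow_le_pow_right (by norm_num) (by omega))
    · -- the conjugate and the norm
      set c'' : Finset (Fin k) → ℚ := cmul α (lo c) (lo c) - a • cmul α (hi c) (hi c) with hc''
      have hev'' : evL s c'' = u * u - (a : ℚ_[p]) * (v * v) := by
        rw [hc'', evL_sub, evL_smul, evL_cmul α s hs, evL_cmul α s hs]
      have hxbar : evL s' (conjLast c) = u - r * v := evL_conjLast s' c
      have hxbar0 : evL s' (conjLast c) ≠ 0 := evL_ne_zero α' hind s' hs' (conjLast_ne_zero hc)
      have hx0 : evL s' c ≠ 0 := evL_ne_zero α' hind s' hs' hc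
      have hnorm : evL s' c * evL s' (conjLast c) = evL s c'' := by
        rw [hx, hxbar, hev'', ← hrr]; ring
      have hc''0 : c'' ≠ 0 := by
        intro h0
        have : evL s c'' = 0 := by rw [h0, evL_zero]
        rw [← hnorm] at this
        rcases mul_eq_zero.mp this with h | h
        · exact hx0 h
        · exact hxbar0 h
      set Dd : ℕ := D * D * ∏ j, (α j).den with hDd
      set D'' : ℕ := Dd * a.den with hD''
      have hden'' : ∀ U, ∃ z : ℤ, (D'' : ℚ) * c'' U = z := by
        intro U
        obtain ⟨z₁, hz₁⟩ := exists_int_cmul α (lo c) (lo c) hden_lo hden_lo U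
        obtain ⟨z₂, hz₂⟩ := exists_int_cmul α (hi c) (hi c) hden_hi hden_hi U
        refine ⟨a.den * z₁ - a.num * z₂, ?_⟩
        rw [hc'', hD'']
        simp only [Pi.sub_apply, Pi.smul_apply, smul_eq_mul]
        push_cast
        rw [← hDd] at hz₁ hz₂
        have ha' : (a.den : ℚ) * a = a.num := by rw [mul_comm]; exact Rat.mul_den_eq_num a
        calc ((Dd : ℚ) * a.den) * (cmul α (lo c) (lo c) U - a * cmul α (hi c) (hi c) U)
            = (a.den : ℚ) * ((Dd : ℚ) * cmul α (lo c) (lo c) U) -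
              ((a.den : ℚ) * a) * ((Dd : ℚ) * cmul α (hi c) (hi c) U) := by ring
          _ = (a.den : ℚ) * z₁ - (a.num : ℚ) * z₂ := by rw [hz₁, hz₂, ha']
      have hD''1 : 1 ≤ D'' := by
        rw [hD'', hDd]
        have h1 : 1 ≤ ∏ j, (α j).den := Finset.one_le_prod' fun j _ => (α j).pos
        have := a.pos
        have : 1 ≤ D * D := Nat.one_le_iff_ne_zero.mpr (by positivity)
        exact Nat.one_le_iff_ne_zero.mpr (by positivity)
      have hD''le : (D'' : ℝ) ≤ D ^ 2 * P * H := by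
        rw [hD'', hDd]; push_cast
        have h1 : ((∏ j, ((α j).den : ℝ))) ≤ P := by
          have := prod_den_le α; push_cast at this; exact this
        have h2 : ((a.den : ℝ)) ≤ H := den_le_hgt a
        calc (D : ℝ) * D * (∏ j, ((α j).den : ℝ)) * a.den ≤ (D : ℝ) * D * P * H :=
            mul_le_mul (mul_le_mul_of_nonneg_left h1 (by positivity)) h2 (by positivity)
              (by positivity)
          _ = (D : ℝ) ^ 2 * P * H := by ring
      have hD''ge : (D : ℝ) ^ 2 ≤ D'' := by
        rw [hD'', hDd]; push_cast
        have h1 : (1 : ℝ) ≤ ∏ j, ((α j).den : ℝ) := by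
          rw [← Nat.cast_prod]; exact_mod_cast Finset.one_le_prod' fun j _ => (α j).pos
        have h2 : (1 : ℝ) ≤ (a.den : ℝ) := by exact_mod_cast a.pos
        calc (D : ℝ) ^ 2 = (D : ℝ) * D * 1 * 1 := by ring
          _ ≤ (D : ℝ) * D * (∏ j, ((α j).den : ℝ)) * a.den :=
              mul_le_mul (mul_le_mul_of_nonneg_left h1 (by positivity)) h2 zero_le_one
                (by positivity)
      set M'' : ℝ := 2 * H * P * M ^ 2 with hM''
      have hPabs : ∏ j, max 1 |(α j : ℝ)| ≤ P := prod_max_one_abs_le α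
      have hc''M : ∑ U, |(c'' U : ℝ)| ≤ M'' := by
        have h1 := l1_cmul_le α (lo c) (lo c)
        have h2 := l1_cmul_le α (hi c) (hi c)
        have hlo2 : (∑ S, |(lo c S : ℝ)|) * ∑ S, |(lo c S : ℝ)| ≤ M ^ 2 := by
          rw [sq]; exact mul_le_mul hlo_le hlo_le (Finset.sum_nonneg fun _ _ => abs_nonneg _)
            (by linarith)
        have hhi2 : (∑ S, |(hi c S : ℝ)|) * ∑ S, |(hi c S : ℝ)| ≤ M ^ 2 := by
          rw [sq]; exact mul_le_mul hhi_le hhi_le (Finset.sum_nonneg fun _ _ => abs_nonneg _)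
            (by linarith)
        have hA : ∑ U, |(cmul α (lo c) (lo c) U : ℝ)| ≤ P * M ^ 2 :=
          h1.trans (mul_le_mul hPabs hlo2 (by positivity) (by positivity))
        have hB : ∑ U, |(cmul α (hi c) (hi c) U : ℝ)| ≤ P * M ^ 2 :=
          h2.trans (mul_le_mul hPabs hhi2 (by positivity) (by positivity))
        have haH : |(a : ℝ)| ≤ H := abs_le_hgt a
        calc ∑ U, |(c'' U : ℝ)|
            ≤ ∑ U, (|(cmul α (lo c) (lo c) U : ℝ)| + |(a : ℝ)| * |(cmul α (hi c) (hi c) U : ℝ)|) := by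
              refine Finset.sum_le_sum fun U _ => ?_
              rw [hc'']
              simp only [Pi.sub_apply, Pi.smul_apply, smul_eq_mul, Rat.cast_sub, Rat.cast_mul]
              calc |(cmul α (lo c) (lo c) U : ℝ) - (a : ℝ) * cmul α (hi c) (hi c) U|
                  ≤ |(cmul α (lo c) (lo c) U : ℝ)| + |(a : ℝ) * cmul α (hi c) (hi c) U| :=
                    abs_sub _ _
                _ = _ := by rw [abs_mul]
          _ = ∑ U, |(cmul α (lo c) (lo c) U : ℝ)| +
                |(a : ℝ)| * ∑ U, |(cmul α (hi c) (hi c) U : ℝ)| := by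
              rw [Finset.sum_add_distrib, Finset.mul_sum]
          _ ≤ P * M ^ 2 + H * (P * M ^ 2) :=
              add_le_add hA (mul_le_mul haH hB (by positivity) (by positivity))
          _ ≤ M'' := by
              have : P * M ^ 2 ≤ H * (P * M ^ 2) := le_mul_of_one_le_left (by positivity) hH1
              rw [hM'']; linarith
      have hM''1 : 1 ≤ M'' := by
        rw [hM'']
        have h1 : 1 ≤ H * P * M ^ 2 :=
          one_le_mul_of_one_le_of_one_le (one_le_mul_of_one_le_of_one_le hH1 hP1) (one_le_pow₀ hM)
        linarith
      have key := ih α hindα s hs hs1 c'' hc''0 D'' hD''1 hden'' M'' hM''1 hc''M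
      -- `‖x̄‖_p ≤ D`
      have hden_conj : ∀ S, ∃ z : ℤ, (D : ℚ) * conjLast c S = z := by
        intro S
        obtain ⟨z, hz⟩ := hden S
        unfold conjLast
        split_ifs
        · exact ⟨-z, by rw [mul_neg, hz, Int.cast_neg]⟩
        · exact ⟨z, hz⟩
      have hxbar_le : ‖evL s' (conjLast c)‖ ≤ D := norm_evL_le_natCast s' hs1' hD hden_conj
      have hxyz : ‖evL s c''‖ ≤ ‖evL s' c‖ * D := by
        rw [← hnorm, norm_mul]
        exact mul_le_mul_of_nonneg_left hxbar_le (norm_nonneg _)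
      rw [hP', hE]
      rw [hM''] at key
      exact padic_numeric_step_sharp hD1 hM hH1 hP1 hD''ge hD''le key hxyz

end Multiquad

end Summit.ABC.StewartYu

end
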